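import Literature.MathematicalPhysics.QuantumFieldTheory.Balaban1983to89.B12AverageCorridor267
import Summits.QuantumFields.BalabanUV.Beta.LinearizingChange267FromQ

/-!
# `T4Continuum.ShellMeasureAverageRegion` — W-d PACKAGING: the printed block average (2.4)∕[B7] (15) over a FINITE
# REGION as ONE chart map `(↥Λ₁ → 𝔸) → (↥Λ₀ → 𝔸)`, p. 267's corridor operator as ONE bounded `ℂ`-linear right
# inverse of its Fréchet derivative, and row D4's `LinearizingChange267FromQ.linearizer_of_Q` FIRED for it — modulo
# the PER-COARSE-BOND chart maps (row S49) and fibre inverses (row S48) BY NAME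
(cell `pub-balaban`, sub-cell `t4`, spine estimate NE7c (node U5b); NE7c ROUND-2 crew seat
`b2b-balaban-t4-ne7c-formalise-leaf-07` gen 4; owner table `t4/b2b-balaban-t4-ne7c-p1/LEAVES-NE7c-P1.md` v2.0, the
«package the finite product — say which» clause of row S48 (iii); ADDITIVE — imports the Literature module
`B12AverageCorridor267` (`Qtilde` = [B12] (2.4) read as the definition of `Q̃` for the single-family average [B7] (15),
under that module's typing) and row D4's `Summits.QuantumFields.BalabanUV.Beta.LinearizingChange267FromQ` ONLY;
[folklore] bookkeeping; data defs `extR`, `resR`, `QtReg`, `hReg` (objects, not propositions); 0 `def … : Prop`,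
0 sorry, 0 citations — page∕equation numbers LOCATE displayed shapes)

HONEST FRAMING.  Finite four-torus programme, rung (B)+1 only — NOT infinite volume, NOT a mass gap, NOT the Clay
problem, NOT summit progress; (B), `BetaPertHyp`, (B^μ) not consumed.  NE7c (`T4IndicatorShell.ShellWeightBound`) is
NOT PRINTED and NOT PROVED; «NE7c ⇐ the named binders» (trigger c3).  This file DISCHARGES NOTHING by itself: the
analyticity, the sup bound and the fibre right inverses of the per-coarse-bond chart averages are BINDERS here (`hQ`,
`hA`, `hM`, `hc`, `hinv`, `hbd`) — rows S49 (owner) and S48 supply them for the printed average; what is proved is the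
finite-product bookkeeping between those per-bond statements and the ONE-MAP hypotheses of `linearizer_of_Q` (row D4's
«NOT CLAIMED» item) and of S46 `ShellMeasureLinearizedFromQ`.  Nothing of [Balaban 1983–89] is asserted.
HONEST DEPENDENCY: continuum YM on T⁴ ⇐ BetaPertH ∧ nine spine estimates (0/9 proved); BetaPertH ⇐ (D1) ∧ (D4) ∧ CAP+tail; G-an2-4 gates asym, D1 and NE2/3/4.

CONTENTS (finite sets `Λ₀` of coarse bonds, `Λ₁ ⊇ ⋃_{c ∈ Λ₀} qppBonds L c` of fine bonds; sup norms).
* §1 `extR Λ` (extension by zero to `ℤᵈ`), `resR` (restriction between regions, a CLM of norm ≤ 1).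
* §2 `QtReg L 𝒯 V Λ₁ Λ₀ B c := Qtilde L 𝒯 V (extR Λ₁ B) c`; `QtReg_zero` («= 0 at 0» OUTRIGHT: `pert 0 V = V`,
  `mlog 1 = 0`).
* §3 from per-bond local maps `Q c : (↥(qppBonds L c) → 𝔸) → 𝔸` with `hQ : Q̃_V(B′)(c) = Q c (B′|_{qppBonds L c})`
  (row S49's identity): `QtReg_apply_eq_local`, **`analyticOnNhd_QtReg`** (`AnalyticOnNhd.pi` + composition with
  `resR`), **`norm_QtReg_le`** (sup norm = max of the per-bond bounds).
* §4 `hReg` — p. 267's corridor operator on the region («(hB)(b₀(c)) = h(c)B(c)», «0 everywhere, except the set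
  {b₀(c)}» — the SHAPE; the fibre maps `hc c` are binders): `hReg_apply_b0Z`, `hReg_apply_of_ne`, `extR_hReg` (= print's
  `hOp b₀ hc` on the extended field), `norm_hReg_le`, and THE CORRIDOR SEPARATION on the region **`resR_hReg`**: on
  `qppBonds L c` the field `hReg D` IS `δ_{b₀(c)}·hc c (D c)` (`B13CorridorSeparation.eq_of_b0Z_mem_qppBonds` BY NAME).
* §5 `hasFDerivAt_QtReg_zero` ∕ `fderiv_QtReg_apply` (the Fréchet derivative of the product map at 0,
  coordinatewise through `resR`) and **`fderiv_QtReg_hReg : DQtReg(0) ∘ hReg = id`** from the per-bond `hinv`.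
* §6 **`linearizer_QtReg`** — `linearizer_of_Q` APPLIED to `QtReg`, `hReg`: [B12] p. 267's substitution
  `B′ = B − hD̃(B)` exists, is unique in the stated ball, vanishes at 0, is analytic — FOR THE PRINTED AVERAGE OVER THE
  REGION, modulo the per-bond binders; `census_QtReg`.  NOT DONE HERE: the per-bond facts (S49 f2, S48); the real form
  `κ := star` (S46∕S47∕S50); the [dict] identification of a live slot's fibre with a fibre of THIS average (node O); the
  torus (DIVERGENCE D-b12g20.1 stands).  NOTHING in the countdown moves; NE7c NOT PROVED; spine 0/9.
-/
noncomputable section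
open Set Metric Function

namespace Summit.QuantumFields.BalabanUV.T4Continuum.ShellMeasureAverageRegion

open Literature.MathematicalPhysics.QuantumFieldTheory.Balaban1983to89
open Literature.MathematicalPhysics.QuantumLattice (ZdEdge)
open B7BlockGeometry (qppBonds)
open B13CorridorSeparation (b0Z b0Z_mem_qppBonds b0Z_injective eq_of_b0Z_mem_qppBonds)
open B13PkLocalTerms (hOp hOp_apply_b₀ hOp_eq_zero_off_range)
open B12AverageCorridor267 (Qtilde pert_zero avgM)
open MatrixLog (mlog_one)
open Summit.QuantumFields.BalabanUV.Beta.LinearizingChange267 (tildeD)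
open Summit.QuantumFields.BalabanUV.Beta.LinearizingChange267FromQ (nonlin rad Mq linearizer_of_Q census_of_Q)
open Literature.MathematicalPhysics.QuantumFieldTheory.Balaban1983to89.B13ExpansionOrder (rem)

variable {d : ℕ} {𝔸 : Type*} [NormedRing 𝔸] [NormedAlgebra ℂ 𝔸]

/-! ## §1 Region charts: extension by zero and restriction -/

section Charts

/-- **EXTENSION BY ZERO** of a field on the finite bond region `Λ` to all bonds of `ℤᵈ`.  An object, not a
proposition. [folklore] -/
def extR (Λ : Finset (ZdEdge d)) (B : ↥Λ → 𝔸) : ZdEdge d → 𝔸 :=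
  fun b => if h : b ∈ Λ then B ⟨b, h⟩ else 0

variable {Λ Λ' : Finset (ZdEdge d)}

omit [NormedAlgebra ℂ 𝔸] in
/-- on the region the extension is the field. [folklore] -/
theorem extR_apply_of_mem (B : ↥Λ → 𝔸) {b : ZdEdge d} (hb : b ∈ Λ) : extR Λ B b = B ⟨b, hb⟩ := dif_pos hb

omit [NormedAlgebra ℂ 𝔸] in
/-- off the region the extension vanishes. [folklore] -/
theorem extR_apply_of_not_mem (B : ↥Λ → 𝔸) {b : ZdEdge d} (hb : b ∉ Λ) : extR Λ B b = 0 := dif_neg hb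

omit [NormedAlgebra ℂ 𝔸] in
/-- `extR Λ 0 = 0`. [folklore] -/
@[simp] theorem extR_zero : extR Λ (0 : ↥Λ → 𝔸) = 0 := by
  funext b; unfold extR; split_ifs <;> rfl

omit [NormedAlgebra ℂ 𝔸] in
/-- the extension by zero IS Mathlib's `Function.extend Subtype.val B 0` (row S49 f2's chart). [folklore] -/
theorem extR_eq_extend (B : ↥Λ → 𝔸) : extR Λ B = Function.extend Subtype.val B 0 := by
  funext b; by_cases hb : b ∈ Λ
  · rw [extR_apply_of_mem B hb]; exact (Subtype.val_injective.extend_apply _ _ ⟨b, hb⟩).symm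
  · rw [extR_apply_of_not_mem B hb, Function.extend_apply' _ _ _ fun ⟨a, ha⟩ => hb (ha ▸ a.2)]; rfl

/-- **RESTRICTION** of a region field to a sub-region, as a continuous `ℂ`-linear map (sup norms).  An object, not a
proposition. [folklore] -/
def resR (h : Λ' ⊆ Λ) : (↥Λ → 𝔸) →L[ℂ] (↥Λ' → 𝔸) :=
  ContinuousLinearMap.pi fun b : ↥Λ' => ContinuousLinearMap.proj (⟨(b : ZdEdge d), h b.2⟩ : ↥Λ)

/-- unfolding. [folklore] -/
@[simp] theorem resR_apply (h : Λ' ⊆ Λ) (B : ↥Λ → 𝔸) (b : ↥Λ') : resR h B b = B ⟨b, h b.2⟩ := rfl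

/-- restriction does not increase the sup norm. [folklore] -/
theorem norm_resR_le (h : Λ' ⊆ Λ) (B : ↥Λ → 𝔸) : ‖resR h B‖ ≤ ‖B‖ :=
  (pi_norm_le_iff_of_nonneg (norm_nonneg B)).2 fun b => by
    rw [resR_apply]; exact norm_le_pi_norm B _

/-- restriction maps the `R`-ball into the `R`-ball. [folklore] -/
theorem resR_mapsTo_ball (h : Λ' ⊆ Λ) (R : ℝ) : MapsTo (resR (𝔸 := 𝔸) h) (ball (0 : ↥Λ → 𝔸) R) (ball 0 R) :=
  fun B hB => mem_ball_zero_iff.2 ((norm_resR_le h B).trans_lt (mem_ball_zero_iff.1 hB))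

/-- restricting the extension by zero recovers the field read on the sub-region. [folklore] -/
theorem resR_eq_extR_restrict (h : Λ' ⊆ Λ) (B : ↥Λ → 𝔸) :
    resR h B = fun b : ↥Λ' => extR Λ B b := by
  funext b; rw [resR_apply, extR_apply_of_mem _ (h b.2)]

end Charts

/-! ## §2 The printed average over a finite region -/

section Region

variable [CompleteSpace 𝔸]
variable (L : ℕ) (𝒯 : (ZdEdge d → 𝔸ˣ) → (Fin d → ℤ) → 𝔸ˣ) (V : ZdEdge d → 𝔸ˣ) (Λ₁ Λ₀ : Finset (ZdEdge d))

/-- **THE PRINTED AVERAGE OVER THE REGION**: for a field `B` on the fine bonds `Λ₁` (extended by zero) and a coarse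
bond `c ∈ Λ₀`, the chart average `Q̃_V(B)(c)` of (2.4)∕[B7] (15) (`B12AverageCorridor267.Qtilde`, VERBATIM).  One map
`(↥Λ₁ → 𝔸) → (↥Λ₀ → 𝔸)` between sup-normed finite products.  An object, not a proposition. [folklore] -/
def QtReg (B : ↥Λ₁ → 𝔸) : ↥Λ₀ → 𝔸 := fun c => Qtilde L 𝒯 V (extR Λ₁ B) c

/-- unfolding. [folklore] -/
theorem QtReg_apply (B : ↥Λ₁ → 𝔸) (c : ↥Λ₀) : QtReg L 𝒯 V Λ₁ Λ₀ B c = Qtilde L 𝒯 V (extR Λ₁ B) c := rfl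

/-- **`QtReg 0 = 0`** — at `B′ = 0` the perturbed configuration is `V` itself (`pert_zero`), the quotient of the
two averages is `1`, and `log 1 = 0` (`MatrixLog.mlog_one`): the «vanishes at 0» clause OUTRIGHT (row S49 f2 exports the
same fact for its local chart; kept inline here so that neither file restates the other). [folklore] -/
@[simp] theorem QtReg_zero : QtReg L 𝒯 V Λ₁ Λ₀ (0 : ↥Λ₁ → 𝔸) = 0 := by
  funext c
  have h0 : Qtilde L 𝒯 V (0 : ZdEdge d → 𝔸) c = 0 := by
    unfold Qtilde
    rw [pert_zero, mul_inv_cancel, Units.val_one, mlog_one, smul_zero]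
  rw [QtReg_apply, extR_zero, h0]; rfl

end Region

/-! ## §3 From the per-coarse-bond local chart maps (row S49's shape) to the region map -/

section Local

variable [CompleteSpace 𝔸]
variable {L : ℕ} {𝒯 : (ZdEdge d → 𝔸ˣ) → (Fin d → ℤ) → 𝔸ˣ} {V : ZdEdge d → 𝔸ˣ} {Λ₁ Λ₀ : Finset (ZdEdge d)}
variable (hcov : ∀ c ∈ Λ₀, qppBonds L c ⊆ Λ₁)
variable {Q : (c : ZdEdge d) → (↥(qppBonds L c) → 𝔸) → 𝔸}
variable (hQ : ∀ c ∈ Λ₀, ∀ B' : ZdEdge d → 𝔸, Qtilde L 𝒯 V B' c = Q c fun b => B' b)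

include hQ in
/-- **THE REGION MAP READ THROUGH THE LOCAL MAPS**: if, per coarse bond `c ∈ Λ₀`,
`Q̃_V(B′)(c) = Q c (B′|_{qppBonds L c})` for every field `B′` (row S49's identity — the average at `c` sees only the
bonds of `B(c₋) ∪ B(c₊)`), then on the region `QtReg B c = Q c (resR B)`. [folklore] -/
theorem QtReg_apply_eq_local (B : ↥Λ₁ → 𝔸) (c : ↥Λ₀) :
    QtReg L 𝒯 V Λ₁ Λ₀ B c = Q c.1 (resR (hcov c.1 c.2) B) := by
  rw [QtReg_apply, hQ c.1 c.2, resR_eq_extR_restrict]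

include hQ in
/-- the region map, coordinate by coordinate, IS `Q c ∘ resR`. [folklore] -/
theorem QtReg_eq_comp :
    QtReg L 𝒯 V Λ₁ Λ₀ = fun (B : ↥Λ₁ → 𝔸) (c : ↥Λ₀) => (Q c.1 ∘ resR (hcov c.1 c.2)) B :=
  funext fun B => funext fun c => QtReg_apply_eq_local hcov hQ B c

include hcov hQ in
/-- **ANALYTICITY OF THE REGION MAP** on `ball 0 R` from the per-bond analyticity on `ball 0 R` (row S49 (A)): each
coordinate is `Q c ∘ resR`, `resR` a continuous linear map sending the ball into the ball; a map into a finite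
product is analytic iff its coordinates are (`AnalyticOnNhd.pi`). [folklore] -/
theorem analyticOnNhd_QtReg {R : ℝ} (hA : ∀ c ∈ Λ₀, AnalyticOnNhd ℂ (Q c) (ball 0 R)) :
    AnalyticOnNhd ℂ (QtReg L 𝒯 V Λ₁ Λ₀) (ball (0 : ↥Λ₁ → 𝔸) R) := by
  rw [QtReg_eq_comp hcov hQ]
  exact AnalyticOnNhd.pi fun c : ↥Λ₀ => by
    have h1 : AnalyticOnNhd ℂ (⇑(resR (𝔸 := 𝔸) (hcov c.1 c.2))) (ball 0 R) :=
      ContinuousLinearMap.analyticOnNhd _ _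
    exact (hA c.1 c.2).comp h1 (resR_mapsTo_ball (hcov c.1 c.2) R)

include hcov hQ in
/-- **THE SUP BOUND OF THE REGION MAP** on `ball 0 R` from the per-bond bounds (row S49 (C)): `‖QtReg B‖ ≤ M`
(sup norm over the coarse bonds of `Λ₀`; `0 ≤ M` displayed for the empty region). [folklore] -/
theorem norm_QtReg_le {R M : ℝ} (hM0 : 0 ≤ M) (hM : ∀ c ∈ Λ₀, ∀ B ∈ ball (0 : ↥(qppBonds L c) → 𝔸) R, ‖Q c B‖ ≤ M) :
    ∀ B ∈ ball (0 : ↥Λ₁ → 𝔸) R, ‖QtReg L 𝒯 V Λ₁ Λ₀ B‖ ≤ M := fun B hB =>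
  (pi_norm_le_iff_of_nonneg hM0).2 fun c => by
    rw [QtReg_apply_eq_local hcov hQ B c]
    exact hM c.1 c.2 _ (resR_mapsTo_ball (hcov c.1 c.2) R hB)

end Local

/-! ## §4 p. 267's corridor operator on the region -/

section Corridor

variable {L : ℕ} (hL : 0 < L) {Λ₁ Λ₀ : Finset (ZdEdge d)}
variable (hc : ZdEdge d → (𝔸 →L[ℂ] 𝔸)) (hmem : ∀ c ∈ Λ₀, b0Z L c ∈ Λ₁)

/-- **THE CORRIDOR OPERATOR ON THE REGION** («The function hB is equal to 0 everywhere, except the set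
{b₀(c) : c ∈ T⁽ᵏ⁺¹⁾} … (hB)(b₀(c)) = h(c)B(c)», [B12] p. 267 — the SHAPE; the fibre maps `hc c` are binders): value
`hc c (D c)` at the corridor bond `b₀(c)` of each `c ∈ Λ₀`, `0` elsewhere; a continuous `ℂ`-linear map. [folklore] -/
def hReg : (↥Λ₀ → 𝔸) →L[ℂ] (↥Λ₁ → 𝔸) :=
  ∑ c : ↥Λ₀, (ContinuousLinearMap.single ℂ (fun _ : ↥Λ₁ => 𝔸) (⟨b0Z L c.1, hmem c.1 c.2⟩ : ↥Λ₁)).comp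
    ((hc c.1).comp (ContinuousLinearMap.proj c))

/-- unfolding: `hReg D = Σ_{c ∈ Λ₀} δ_{b₀(c)}·hc c (D c)`. [folklore] -/
theorem hReg_apply (D : ↥Λ₀ → 𝔸) :
    hReg hc hmem D = ∑ c : ↥Λ₀, (Pi.single (⟨b0Z L c.1, hmem c.1 c.2⟩ : ↥Λ₁) (hc c.1 (D c)) : ↥Λ₁ → 𝔸) := by
  simp only [hReg, _root_.sum_apply, ContinuousLinearMap.comp_apply, ContinuousLinearMap.proj_apply,
    ContinuousLinearMap.single_apply]

include hL in
/-- **«(hB)(b₀(c)) = h(c)B(c)»** on the region: at the corridor bond of `c ∈ Λ₀` the value is `hc c (D c)`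
(`b₀` injective, `B13CorridorSeparation.b0Z_injective`). [folklore] -/
theorem hReg_apply_b0Z (D : ↥Λ₀ → 𝔸) (c : ↥Λ₀) :
    hReg hc hmem D ⟨b0Z L c.1, hmem c.1 c.2⟩ = hc c.1 (D c) := by
  rw [hReg_apply, Finset.sum_apply, Finset.sum_eq_single c]
  · simp
  · intro c' _ hc'
    rw [Pi.single_eq_of_ne]
    intro h
    exact hc' (Subtype.ext (b0Z_injective hL (congrArg Subtype.val h))).symm
  · exact fun h => (h (Finset.mem_univ c)).elim

/-- **«equal to 0 everywhere, except the set {b₀(c)}»** on the region: off the corridor bonds of `Λ₀` the value is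
`0`. [folklore] -/
theorem hReg_apply_of_ne (D : ↥Λ₀ → 𝔸) (b : ↥Λ₁) (hb : ∀ c ∈ Λ₀, b0Z L c ≠ b) :
    hReg hc hmem D b = 0 := by
  rw [hReg_apply, Finset.sum_apply]
  refine Finset.sum_eq_zero fun c _ => ?_
  rw [Pi.single_eq_of_ne]
  exact fun h => hb c.1 c.2 (congrArg Subtype.val h.symm)

include hL in
/-- the region corridor operator, extended by zero, IS print's diagonal operator `B13PkLocalTerms.hOp b₀ hc` on the
coarse field extended by zero — the shape of `h_paragraph_p267_genuine`'s «LQ̃h = I». [folklore] -/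
theorem extR_hReg (D : ↥Λ₀ → 𝔸) :
    extR Λ₁ (hReg hc hmem D) = hOp (b0Z L) (fun c X => hc c X) (extR Λ₀ D) := by
  funext b
  by_cases hcor : ∃ c, b0Z L c = b
  · obtain ⟨c, rfl⟩ := hcor
    rw [hOp_apply_b₀ (b0Z_injective hL)]
    by_cases hc0 : c ∈ Λ₀
    · rw [extR_apply_of_mem _ (hmem c hc0), extR_apply_of_mem _ hc0]
      exact hReg_apply_b0Z hL hc hmem D ⟨c, hc0⟩
    · rw [extR_apply_of_not_mem _ hc0, map_zero]
      by_cases hb1 : b0Z L c ∈ Λ₁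
      · rw [extR_apply_of_mem _ hb1]
        refine hReg_apply_of_ne hc hmem D _ fun c' hc' h => hc0 ?_
        have hcc : c' = c := b0Z_injective hL (by simpa using h)
        exact hcc ▸ hc'
      · exact extR_apply_of_not_mem _ hb1
  · rw [hOp_eq_zero_off_range _ _ hcor]
    by_cases hb1 : b ∈ Λ₁
    · rw [extR_apply_of_mem _ hb1]
      exact hReg_apply_of_ne hc hmem D _ fun c _ h => hcor ⟨c, h⟩
    · exact extR_apply_of_not_mem _ hb1

include hL in
/-- **THE NORM OF THE CORRIDOR OPERATOR**: one fibre bound `‖hc c X‖ ≤ b‖X‖` for the coarse bonds of `Λ₀` gives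
`‖hReg D‖ ≤ b‖D‖` (sup norms; at each fine bond at most ONE coarse bond contributes, `b₀` injective). [folklore] -/
theorem norm_hReg_apply_le {b : ℝ} (hb0 : 0 ≤ b) (hbd : ∀ c ∈ Λ₀, ∀ X, ‖hc c X‖ ≤ b * ‖X‖) (D : ↥Λ₀ → 𝔸)
    (b' : ↥Λ₁) : ‖hReg hc hmem D b'‖ ≤ b * ‖D‖ := by
  by_cases hcor : ∃ c : ↥Λ₀, (⟨b0Z L c.1, hmem c.1 c.2⟩ : ↥Λ₁) = b'
  · obtain ⟨c, rfl⟩ := hcor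
    rw [hReg_apply_b0Z hL hc hmem D c]
    exact (hbd c.1 c.2 _).trans (mul_le_mul_of_nonneg_left (norm_le_pi_norm D c) hb0)
  · rw [hReg_apply_of_ne hc hmem D b' fun c hc0 h => hcor ⟨⟨c, hc0⟩, Subtype.ext h⟩, norm_zero]
    exact mul_nonneg hb0 (norm_nonneg D)

include hL in
/-- hence `‖hReg D‖ ≤ b‖D‖` (sup norm). [folklore] -/
theorem norm_hReg_le {b : ℝ} (hb0 : 0 ≤ b) (hbd : ∀ c ∈ Λ₀, ∀ X, ‖hc c X‖ ≤ b * ‖X‖) (D : ↥Λ₀ → 𝔸) :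
    ‖hReg hc hmem D‖ ≤ b * ‖D‖ :=
  (pi_norm_le_iff_of_nonneg (mul_nonneg hb0 (norm_nonneg D))).2 (norm_hReg_apply_le hL hc hmem hb0 hbd D)

include hL in
/-- the operator norm form. [folklore] -/
theorem opNorm_hReg_le {b : ℝ} (hb0 : 0 ≤ b) (hbd : ∀ c ∈ Λ₀, ∀ X, ‖hc c X‖ ≤ b * ‖X‖) : ‖hReg hc hmem‖ ≤ b :=
  ContinuousLinearMap.opNorm_le_bound _ hb0 (norm_hReg_le hL hc hmem hb0 hbd)

include hL in
/-- **THE CORRIDOR SEPARATION READ ON THE REGION**: on the bonds of `B(c₋) ∪ B(c₊)` (`c ∈ Λ₀`) the field `hReg D`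
IS `δ_{b₀(c)}·hc c (D c)` — other corridor bonds lie outside `qppBonds L c` (`eq_of_b0Z_mem_qppBonds`). [folklore] -/
theorem resR_hReg (hcov : ∀ c ∈ Λ₀, qppBonds L c ⊆ Λ₁) (D : ↥Λ₀ → 𝔸) (c : ↥Λ₀) :
    resR (hcov c.1 c.2) (hReg hc hmem D) =
      Pi.single (⟨b0Z L c.1, b0Z_mem_qppBonds hL c.1⟩ : ↥(qppBonds L c.1)) (hc c.1 (D c)) := by
  funext b
  rw [resR_apply]
  by_cases hb : (⟨b0Z L c.1, b0Z_mem_qppBonds hL c.1⟩ : ↥(qppBonds L c.1)) = b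
  · subst hb
    rw [Pi.single_eq_same]
    exact hReg_apply_b0Z hL hc hmem D c
  · rw [Pi.single_eq_of_ne (Ne.symm hb)]
    refine hReg_apply_of_ne hc hmem D _ fun c' hc' h => hb (Subtype.ext ?_)
    have hmemq : b0Z L c' ∈ qppBonds L c.1 := by rw [h]; exact b.2
    have hcc : c' = c.1 := eq_of_b0Z_mem_qppBonds hL hmemq
    rw [← h, hcc]

end Corridor

/-! ## §5 The Fréchet derivative of the region map and its corridor right inverse -/

section Derivative

variable [CompleteSpace 𝔸]
variable {L : ℕ} (hL : 0 < L) {𝒯 : (ZdEdge d → 𝔸ˣ) → (Fin d → ℤ) → 𝔸ˣ} {V : ZdEdge d → 𝔸ˣ}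
  {Λ₁ Λ₀ : Finset (ZdEdge d)} (hcov : ∀ c ∈ Λ₀, qppBonds L c ⊆ Λ₁)
  {Q : (c : ZdEdge d) → (↥(qppBonds L c) → 𝔸) → 𝔸}
  (hQ : ∀ c ∈ Λ₀, ∀ B' : ZdEdge d → 𝔸, Qtilde L 𝒯 V B' c = Q c fun b => B' b)
  {R : ℝ} (hR : 0 < R) (hA : ∀ c ∈ Λ₀, AnalyticOnNhd ℂ (Q c) (ball 0 R))

include hQ hR hA in
/-- **THE FRÉCHET DERIVATIVE OF THE REGION MAP AT `0`** is the product of the per-bond derivatives composed with the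
restrictions: `DQtReg(0) = (c ↦ DQ_c(0) ∘ resR)` (`hasFDerivAt_pi`, chain rule through the CLM `resR`). [folklore] -/
theorem hasFDerivAt_QtReg_zero :
    HasFDerivAt (QtReg L 𝒯 V Λ₁ Λ₀)
      (ContinuousLinearMap.pi fun c : ↥Λ₀ => (fderiv ℂ (Q c.1) 0).comp (resR (hcov c.1 c.2))) 0 := by
  rw [QtReg_eq_comp hcov hQ]
  refine hasFDerivAt_pi.2 fun c => ?_
  have h0 : (resR (𝔸 := 𝔸) (hcov c.1 c.2)) 0 = 0 := map_zero _
  have hd : HasFDerivAt (Q c.1) (fderiv ℂ (Q c.1) 0) ((resR (hcov c.1 c.2)) (0 : ↥Λ₁ → 𝔸)) := by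
    rw [h0]
    exact ((hA c.1 c.2 0 (mem_ball_self hR)).differentiableAt).hasFDerivAt
  have h2 : HasFDerivAt (⇑(resR (𝔸 := 𝔸) (hcov c.1 c.2))) (resR (hcov c.1 c.2)) 0 :=
    ContinuousLinearMap.hasFDerivAt _
  exact hd.comp 0 h2

include hQ hR hA in
/-- coordinatewise: `DQtReg(0)·v` at the coarse bond `c` is `DQ_c(0)·(v|_{qppBonds L c})`. [folklore] -/
theorem fderiv_QtReg_apply (v : ↥Λ₁ → 𝔸) (c : ↥Λ₀) :
    fderiv ℂ (QtReg L 𝒯 V Λ₁ Λ₀) 0 v c = fderiv ℂ (Q c.1) 0 (resR (hcov c.1 c.2) v) := by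
  rw [(hasFDerivAt_QtReg_zero hcov hQ hR hA).fderiv]
  rfl

include hL hcov hQ hR hA in
/-- **«LQ̃h = I» FOR THE REGION MAP**: if, per coarse bond, `hc c` inverts the Fréchet derivative of the local chart
map along the corridor bond — `DQ_c(0)·(δ_{b₀(c)}·hc c X) = X` (row S48's reading of p. 267's `h(c)` «an inverse of a
coefficient at the variable B′(b₀(c)) in (Q̃B′)(c), multiplied by L⁻¹») — then `DQtReg(0) ∘ hReg = id`; the corridor
separation (`resR_hReg`) kills every cross term. [folklore] -/
theorem fderiv_QtReg_hReg (hc : ZdEdge d → (𝔸 →L[ℂ] 𝔸)) (hmem : ∀ c ∈ Λ₀, b0Z L c ∈ Λ₁)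
    (hinv : ∀ c ∈ Λ₀, ∀ X : 𝔸,
      fderiv ℂ (Q c) 0 (Pi.single (⟨b0Z L c, b0Z_mem_qppBonds hL c⟩ : ↥(qppBonds L c)) (hc c X)) = X)
    (D : ↥Λ₀ → 𝔸) : fderiv ℂ (QtReg L 𝒯 V Λ₁ Λ₀) 0 (hReg hc hmem D) = D :=
  funext fun c => by rw [fderiv_QtReg_apply hcov hQ hR hA, resR_hReg hL hc hmem hcov D c, hinv c.1 c.2]

end Derivative

/-! ## §6 APEX: [B12] p. 267's linearizing substitution EXISTS for the printed average over the region -/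

section Apex

variable [CompleteSpace 𝔸]
variable {L : ℕ} (hL : 0 < L) {𝒯 : (ZdEdge d → 𝔸ˣ) → (Fin d → ℤ) → 𝔸ˣ} {V : ZdEdge d → 𝔸ˣ}
  {Λ₁ Λ₀ : Finset (ZdEdge d)} (hcov : ∀ c ∈ Λ₀, qppBonds L c ⊆ Λ₁)
  {Q : (c : ZdEdge d) → (↥(qppBonds L c) → 𝔸) → 𝔸}
  (hQ : ∀ c ∈ Λ₀, ∀ B' : ZdEdge d → 𝔸, Qtilde L 𝒯 V B' c = Q c fun b => B' b)
  {R M : ℝ} (hR : 0 < R) (hA : ∀ c ∈ Λ₀, AnalyticOnNhd ℂ (Q c) (ball 0 R))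
  (hM0 : 0 ≤ M) (hM : ∀ c ∈ Λ₀, ∀ B ∈ ball (0 : ↥(qppBonds L c) → 𝔸) R, ‖Q c B‖ ≤ M)
  (hc : ZdEdge d → (𝔸 →L[ℂ] 𝔸)) (hmem : ∀ c ∈ Λ₀, b0Z L c ∈ Λ₁)
  (hinv : ∀ c ∈ Λ₀, ∀ X : 𝔸,
    fderiv ℂ (Q c) 0 (Pi.single (⟨b0Z L c, b0Z_mem_qppBonds hL c⟩ : ↥(qppBonds L c)) (hc c X)) = X)

include hL hcov hQ hR hA hM0 hM hinv in
/-- **[B12] p. 267 FOR THE PRINTED AVERAGE OVER A FINITE REGION** (`LinearizingChange267FromQ.linearizer_of_Q` APPLIED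
to `QtReg` and `hReg`; every one of its four hypotheses on `Qt` discharged by §2–§5 from the PER-BOND binders
`hQ`∕`hA`∕`hM`∕`hinv`).  With row D4's CONSTRUCTED radii (`rad`, `Mq`) and `D̃ := tildeD (nonlin QtReg) hReg ρ σ`:
(i) «the transformation B′ = B − hD̃(B) linearizes the function Q̃(B′)» — `QtReg (B − hReg (D̃ B)) = DQtReg(0)·B` on
`‖B‖ ≤ ρ`; (ii) «exactly one solution» in the `σ`-ball; (iii) `D̃ 0 = 0`; (iv) «an analytic function of B» on
`ball 0 ρ`.  CONDITIONAL on the per-bond binders (rows S49∕S48 supply them for [B7] (15)); nothing printed is asserted;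
NOT Bałaban's k-fold average on the torus (the Literature module's corner-cube∕`ℤᵈ` typing stands). [folklore] -/
theorem linearizer_QtReg :
    let r := rad R M ‖hReg hc hmem‖; let σ := (Real.toNNReal (4 * Mq R M * r) : ℝ) * r; let ρ := r / 4
    let Dt := tildeD (nonlin (QtReg L 𝒯 V Λ₁ Λ₀)) (hReg hc hmem) ρ σ
    (∀ B ∈ closedBall (0 : ↥Λ₁ → 𝔸) ρ,
        QtReg L 𝒯 V Λ₁ Λ₀ (B - hReg hc hmem (Dt B)) = fderiv ℂ (QtReg L 𝒯 V Λ₁ Λ₀) 0 B) ∧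
      (∀ B ∈ closedBall (0 : ↥Λ₁ → 𝔸) ρ, ∀ D ∈ closedBall (0 : ↥Λ₀ → 𝔸) σ,
        QtReg L 𝒯 V Λ₁ Λ₀ (B - hReg hc hmem D) = fderiv ℂ (QtReg L 𝒯 V Λ₁ Λ₀) 0 B → D = Dt B) ∧
      Dt 0 = 0 ∧ AnalyticOnNhd ℂ Dt (ball (0 : ↥Λ₁ → 𝔸) ρ) :=
  linearizer_of_Q hR (analyticOnNhd_QtReg hcov hQ hA) (norm_QtReg_le hcov hQ hM0 hM) (QtReg_zero L 𝒯 V Λ₁ Λ₀)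
    (hReg hc hmem) (fderiv_QtReg_hReg hL hcov hQ hR hA hc hmem hinv)

include hcov hQ hR hA hM0 hM in
/-- **THE (2.12)-CENSUS INPUTS FOR THE PRINTED AVERAGE OVER THE REGION** (`LinearizingChange267FromQ.census_of_Q`
APPLIED): `‖D̃w‖ ≤ (σ∕ρ²)‖w‖²` and `‖D̃₃w‖ ≤ (2σ∕ρ³)‖w‖³` on `ball 0 ρ`, same constructed data.  Conditional as above.
[folklore] -/
theorem census_QtReg :
    let r := rad R M ‖hReg hc hmem‖; let σ := (Real.toNNReal (4 * Mq R M * r) : ℝ) * r; let ρ := r / 4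
    let Dt := tildeD (nonlin (QtReg L 𝒯 V Λ₁ Λ₀)) (hReg hc hmem) ρ σ
    (∀ w ∈ ball (0 : ↥Λ₁ → 𝔸) ρ, ‖Dt w‖ ≤ σ / ρ ^ 2 * ‖w‖ ^ 2) ∧
      ∀ w ∈ ball (0 : ↥Λ₁ → 𝔸) ρ, ‖rem Dt 2 w‖ ≤ 2 * σ / ρ ^ 3 * ‖w‖ ^ 3 :=
  census_of_Q hR (analyticOnNhd_QtReg hcov hQ hA) (norm_QtReg_le hcov hQ hM0 hM) (QtReg_zero L 𝒯 V Λ₁ Λ₀)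
    (hReg hc hmem)

end Apex

end Summit.QuantumFields.BalabanUV.T4Continuum.ShellMeasureAverageRegion

end
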